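import Summits.NavierStokesRegularity.NavierStokesRegularity.Theorems.NoOverheating.Negative.RotatedDSSVorticityDirection
import Literature.Analysis.FluidPDE.SuitableWeak
import Literature.Analysis.FluidPDE.SpaceTimeMollifier
import HarnessLib

/-!
# Kinematics for census strata (S15)/(S16): under rotated discrete self-similarity the distance of
# the velocity (vorticity) to an `R`-invariant line scales by `c⁻¹` (`c⁻²`) across one period;
# a unidirectional divergence-free field is translation invariant along its direction

Refuter seat (ns-blowup-refuter g18), kernel census for crux K2 `NoOverheating`
(stmt-NavierStokesRegularity-19960) of route `AngularGalerkinLadder`, Negative lane (`--supports`).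
ROUTE-INDEPENDENT module (no `Theses` import, D-lint `theses-cone`): pure kinematics of rotated-DSS
fields `c Rᵀu(c²t, cRx) = u(t, x)` on `ℝ × ℝ³`; the rung / window consequences are drawn in
`TransversalComponentsWindowsExcluded`.  No definition, no named fact; nothing is asserted about
Navier–Stokes.

* `norm_sub_proj_smul_le` — the orthogonal residual `w − (⟪e,w⟫/‖e‖²) e` minimises `‖w − a e‖`;
  `eq_proj_smul_of_eventually_norm_sub_smul_le` — a vector within `M/cᵏ` of the line `ℝe` for all
  large `k` lies on it.
* `exists_norm_sub_smul_eq_of_isRotatedDSS` / `exists_norm_curl_sub_smul_eq_of_isRotatedDSS` — for an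
  `R`-invariant line (`R e = e ∨ R e = −e`; for `e ≠ 0`: `e` spans the rotation axis of `R` or of
  `−R` — by Euler's rotation theorem every `R ∈ O(3)` has such an `e ≠ 0`) the distance of `u(s, x)`
  (resp. `ω(s, x)`) to `ℝe` is `c⁻¹` (resp. `c⁻²`) times that of `u(s/c², c⁻¹R⁻¹x)` (resp. `ω`) —
  from `u(s, x) = R(c⁻¹u(s/c², c⁻¹R⁻¹x))` (`slice_eq_conj_of_isRotatedDSS`, KJ-46) and
  `ω(s, x) = (det R) c⁻² R ω(s/c², c⁻¹R⁻¹x)` (`curl_slice_eq_of_isRotatedDSS`).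
* `dist_axis_le_of_mem_parabolicCylinder_pow` / `dist_axis_curl_le_of_mem_parabolicCylinder_pow` — a
  bound `dist ≤ M` on the backward parabolic cylinder `Q_ρ(0,0) = (−ρ², 0) × B_ρ(0)` propagates to
  `M/cᵏ` (`M/c²ᵏ`) on `Q_{cᵏρ}(0,0)` (Chae–Wolf's §3 Step 1 run on the distance to a line), and
  `exists_eq_smul_of_dist_axis_le_parabolicCylinder` /
  `exists_curl_eq_smul_of_dist_axis_le_parabolicCylinder` — since every `(t, x)`, `t < 0`, lies in
  `Q_{cᵏρ}(0,0)` for all large `k`, the velocity (vorticity) is everywhere PARALLEL to `ℝe` on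
  `t < 0` (with `e = 0`: it vanishes — Chae–Wolf's bounded-DSS exclusion, resp. (S14)).
* `eq_of_parallel_of_isDivFree` — a `C²` divergence-free `v = a(·) e`, `e ≠ 0`, has
  `∂ₑa = div v = 0`, hence `v(x + s e) = v(x)` (the one-line version of Giga–Miura's slice lemma).

References: [cite: ChaeWolf2017, §3, Step 1]; [cite: GigaMiura2011, Prop. 2.2, proof (§2.1)].
-/

noncomputable section

namespace Summit.NavierStokesRegularity.AngularGalerkinLadderTransversalAxisKinematics

open Set Function Filter Topology Metric
open Literature.Analysis Literature.Analysis.FluidPDE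
open Summit.NavierStokesRegularity.AngularGalerkinLadderRotatedDSSVorticityDirection
open scoped RealInnerProductSpace

/-! ### §0 Distance to a line: the orthogonal residual is the minimiser -/

/-- For any `w, e` and any scalar `a`, the orthogonal residual `w − (⟪e, w⟫/‖e‖²) e` is no longer
than `w − a e` (Pythagoras; for `e = 0` both sides are `‖w‖`). [folklore] -/
theorem norm_sub_proj_smul_le (w e : EuclideanSpace ℝ (Fin 3)) (a : ℝ) :
    ‖w - (⟪e, w⟫ / ‖e‖ ^ 2) • e‖ ≤ ‖w - a • e‖ := by
  by_cases he : e = 0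
  · simp [he]
  set q : ℝ := ⟪e, w⟫ / ‖e‖ ^ 2 with hq
  have he2 : ‖e‖ ^ 2 ≠ 0 := pow_ne_zero 2 (norm_ne_zero_iff.2 he)
  have horth : ⟪w - q • e, (q - a) • e⟫ = 0 := by
    rw [inner_smul_right, inner_sub_left, inner_smul_left, real_inner_comm e w,
      real_inner_self_eq_norm_sq, hq]
    simp only [RCLike.conj_to_real]
    rw [div_mul_cancel₀ _ he2, sub_self, mul_zero]
  have hdec : w - a • e = (w - q • e) + (q - a) • e := by
    rw [sub_smul]; abel
  have hsq : ‖w - a • e‖ * ‖w - a • e‖ =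
      ‖w - q • e‖ * ‖w - q • e‖ + ‖(q - a) • e‖ * ‖(q - a) • e‖ := by
    rw [hdec]; exact norm_add_sq_eq_norm_sq_add_norm_sq_real horth
  rw [mul_self_le_mul_self_iff (norm_nonneg _) (norm_nonneg _), hsq]
  nlinarith [norm_nonneg ((q - a) • e)]

/-- A vector at distance `0` from every `M/cᵏ`-neighbourhood of the line `ℝe` lies on it: if for
eventually all `k` some `a` has `‖w − a e‖ ≤ M/cᵏ` (`1 < c`), then `w = (⟪e, w⟫/‖e‖²) e`. [folklore] -/
theorem eq_proj_smul_of_eventually_norm_sub_smul_le {w e : EuclideanSpace ℝ (Fin 3)} {c M : ℝ}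
    (hc : 1 < c) (h : ∀ᶠ k : ℕ in atTop, ∃ a : ℝ, ‖w - a • e‖ ≤ M / c ^ k) :
    w = (⟪e, w⟫ / ‖e‖ ^ 2) • e := by
  have hev : ∀ᶠ k : ℕ in atTop, ‖w - (⟪e, w⟫ / ‖e‖ ^ 2) • e‖ ≤ M / c ^ k := by
    filter_upwards [h] with k hk
    obtain ⟨a, ha⟩ := hk
    exact (norm_sub_proj_smul_le w e a).trans ha
  have hlim : Tendsto (fun k : ℕ => M / c ^ k) atTop (𝓝 0) :=
    tendsto_const_nhds.div_atTop (tendsto_pow_atTop_atTop_of_one_lt hc)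
  exact sub_eq_zero.1 (norm_le_zero_iff.1 (ge_of_tendsto hlim hev))

/-! ### §1 Kinematics: the distance to an `R`-invariant line scales across one period -/

section Kinematics

variable {c : ℝ} {R : EuclideanSpace ℝ (Fin 3) ≃ₗᵢ[ℝ] EuclideanSpace ℝ (Fin 3)}
  {u : ℝ → EuclideanSpace ℝ (Fin 3) → EuclideanSpace ℝ (Fin 3)} {e : EuclideanSpace ℝ (Fin 3)}

/-- An `R`-invariant line is mapped into itself by every `γ • R`: `γ • R (a e) ∈ ℝe`. [folklore] -/
theorem exists_smul_eq_smul_map_smul (hRe : R e = e ∨ R e = -e) (γ a : ℝ) :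
    ∃ b : ℝ, b • e = γ • R (a • e) := by
  rcases hRe with h1 | h1
  · exact ⟨γ * a, by rw [LinearIsometryEquiv.map_smul, h1, smul_smul]⟩
  · exact ⟨-(γ * a), by rw [LinearIsometryEquiv.map_smul, h1, smul_neg, smul_neg, smul_smul, neg_smul]⟩

/-- **Velocity: the distance to an `R`-invariant line scales by `c⁻¹` across one period.** With
`y = c⁻¹R⁻¹x`: for every `a` there is `b` with `‖u(s, x) − b e‖ = c⁻¹ ‖u(s/c², y) − a e‖`.
[cite: ChaeWolf2017, §3, Step 1] -/
theorem exists_norm_sub_smul_eq_of_isRotatedDSS (h : IsRotatedDSS c R u) (hc : 0 < c)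
    (hRe : R e = e ∨ R e = -e) (s : ℝ) (x : EuclideanSpace ℝ (Fin 3)) (a : ℝ) :
    ∃ b : ℝ, ‖u s x - b • e‖ = c⁻¹ * ‖u (s / c ^ 2) (c⁻¹ • R.symm x) - a • e‖ := by
  obtain ⟨b, hb⟩ := exists_smul_eq_smul_map_smul hRe c⁻¹ a
  refine ⟨b, ?_⟩
  have hu : u s x = R (c⁻¹ • u (s / c ^ 2) (c⁻¹ • R.symm x)) :=
    congrFun (slice_eq_conj_of_isRotatedDSS h hc.ne' s) x
  rw [hu, hb, LinearIsometryEquiv.map_smul, ← smul_sub, ← map_sub, norm_smul,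
    LinearIsometryEquiv.norm_map, Real.norm_of_nonneg (inv_nonneg.2 hc.le)]

/-- **Vorticity: the distance to an `R`-invariant line scales by `c⁻²` across one period.**
[cite: ChaeWolf2017, §3, Step 1] -/
theorem exists_norm_curl_sub_smul_eq_of_isRotatedDSS (h : IsRotatedDSS c R u) (hc : 0 < c)
    (hRe : R e = e ∨ R e = -e) (s : ℝ) (x : EuclideanSpace ℝ (Fin 3)) (a : ℝ) :
    ∃ b : ℝ, ‖curl (u s) x - b • e‖ =
      (c⁻¹) ^ 2 * ‖curl (u (s / c ^ 2)) (c⁻¹ • R.symm x) - a • e‖ := by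
  obtain ⟨b, hb⟩ := exists_smul_eq_smul_map_smul hRe
    ((R : EuclideanSpace ℝ (Fin 3) →L[ℝ] EuclideanSpace ℝ (Fin 3)).det * (c⁻¹) ^ 2) a
  refine ⟨b, ?_⟩
  rw [curl_slice_eq_of_isRotatedDSS h hc.ne' s x, hb, ← smul_sub, ← map_sub, norm_smul,
    LinearIsometryEquiv.norm_map, Real.norm_eq_abs, abs_mul, abs_det_linearIsometryEquiv, one_mul,
    abs_of_nonneg (sq_nonneg _)]

/-- **Propagation of a transversal velocity bound outward.** If `dist(u, ℝe) ≤ M` on `Q_ρ(0,0)`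
then `dist(u, ℝe) ≤ M/cᵏ` on `Q_{cᵏρ}(0,0)`: the contracted preimage `(t/c², c⁻¹R⁻¹x)` of a point
of `Q_{c^{k+1}ρ}` lies in `Q_{cᵏρ}`. [cite: ChaeWolf2017, §3, Step 1] -/
theorem dist_axis_le_of_mem_parabolicCylinder_pow (h : IsRotatedDSS c R u) (hc : 1 < c)
    (hRe : R e = e ∨ R e = -e) {ρ M : ℝ}
    (hM : ∀ z ∈ parabolicCylinder ρ (0 : ℝ × EuclideanSpace ℝ (Fin 3)),
      ∃ a : ℝ, ‖u z.1 z.2 - a • e‖ ≤ M)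
    (k : ℕ) : ∀ t : ℝ, ∀ x : EuclideanSpace ℝ (Fin 3),
      ((t, x) : ℝ × EuclideanSpace ℝ (Fin 3)) ∈
          parabolicCylinder (c ^ k * ρ) (0 : ℝ × EuclideanSpace ℝ (Fin 3)) →
        ∃ a : ℝ, ‖u t x - a • e‖ ≤ M / c ^ k := by
  have hc0 : 0 < c := zero_lt_one.trans hc
  induction k with
  | zero =>
    intro t x hz
    simpa using hM (t, x) (by simpa using hz)
  | succ k ih =>
    intro t x hz
    simp only [mem_parabolicCylinder, Prod.fst_zero, Prod.snd_zero, zero_sub, dist_zero_right] at hz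
    obtain ⟨⟨ht1, ht2⟩, hx⟩ := hz
    have hz' : ((t / c ^ 2, c⁻¹ • R.symm x) : ℝ × EuclideanSpace ℝ (Fin 3)) ∈
        parabolicCylinder (c ^ k * ρ) (0 : ℝ × EuclideanSpace ℝ (Fin 3)) := by
      simp only [mem_parabolicCylinder, Prod.fst_zero, Prod.snd_zero, zero_sub, dist_zero_right]
      refine ⟨⟨?_, ?_⟩, ?_⟩
      · rw [lt_div_iff₀ (pow_pos hc0 2)]
        have : (c ^ (k + 1) * ρ) ^ 2 = (c ^ k * ρ) ^ 2 * c ^ 2 := by ring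
        linarith
      · exact div_neg_of_neg_of_pos ht2 (pow_pos hc0 2)
      · rw [norm_smul, LinearIsometryEquiv.norm_map, Real.norm_of_nonneg (inv_nonneg.2 hc0.le),
          inv_mul_lt_iff₀ hc0]
        calc ‖x‖ < c ^ (k + 1) * ρ := hx
          _ = c * (c ^ k * ρ) := by ring
    obtain ⟨a, ha⟩ := ih _ _ hz'
    obtain ⟨b, hb⟩ := exists_norm_sub_smul_eq_of_isRotatedDSS h hc0 hRe t x a
    refine ⟨b, ?_⟩
    calc ‖u t x - b • e‖ = c⁻¹ * ‖u (t / c ^ 2) (c⁻¹ • R.symm x) - a • e‖ := hb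
      _ ≤ c⁻¹ * (M / c ^ k) := mul_le_mul_of_nonneg_left ha (inv_nonneg.2 hc0.le)
      _ = M / c ^ (k + 1) := by rw [pow_succ c k, inv_mul_eq_div, div_div]

/-- **Propagation of a transversal vorticity bound outward**: `dist(ω, ℝe) ≤ M` on `Q_ρ(0,0)` gives
`dist(ω, ℝe) ≤ M/(c²)ᵏ` on `Q_{cᵏρ}(0,0)`. [cite: ChaeWolf2017, §3, Step 1] -/
theorem dist_axis_curl_le_of_mem_parabolicCylinder_pow (h : IsRotatedDSS c R u) (hc : 1 < c)
    (hRe : R e = e ∨ R e = -e) {ρ M : ℝ}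
    (hM : ∀ z ∈ parabolicCylinder ρ (0 : ℝ × EuclideanSpace ℝ (Fin 3)),
      ∃ a : ℝ, ‖curl (u z.1) z.2 - a • e‖ ≤ M)
    (k : ℕ) : ∀ t : ℝ, ∀ x : EuclideanSpace ℝ (Fin 3),
      ((t, x) : ℝ × EuclideanSpace ℝ (Fin 3)) ∈
          parabolicCylinder (c ^ k * ρ) (0 : ℝ × EuclideanSpace ℝ (Fin 3)) →
        ∃ a : ℝ, ‖curl (u t) x - a • e‖ ≤ M / (c ^ 2) ^ k := by
  have hc0 : 0 < c := zero_lt_one.trans hc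
  induction k with
  | zero =>
    intro t x hz
    simpa using hM (t, x) (by simpa using hz)
  | succ k ih =>
    intro t x hz
    simp only [mem_parabolicCylinder, Prod.fst_zero, Prod.snd_zero, zero_sub, dist_zero_right] at hz
    obtain ⟨⟨ht1, ht2⟩, hx⟩ := hz
    have hz' : ((t / c ^ 2, c⁻¹ • R.symm x) : ℝ × EuclideanSpace ℝ (Fin 3)) ∈
        parabolicCylinder (c ^ k * ρ) (0 : ℝ × EuclideanSpace ℝ (Fin 3)) := by
      simp only [mem_parabolicCylinder, Prod.fst_zero, Prod.snd_zero, zero_sub, dist_zero_right]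
      refine ⟨⟨?_, ?_⟩, ?_⟩
      · rw [lt_div_iff₀ (pow_pos hc0 2)]
        have : (c ^ (k + 1) * ρ) ^ 2 = (c ^ k * ρ) ^ 2 * c ^ 2 := by ring
        linarith
      · exact div_neg_of_neg_of_pos ht2 (pow_pos hc0 2)
      · rw [norm_smul, LinearIsometryEquiv.norm_map, Real.norm_of_nonneg (inv_nonneg.2 hc0.le),
          inv_mul_lt_iff₀ hc0]
        calc ‖x‖ < c ^ (k + 1) * ρ := hx
          _ = c * (c ^ k * ρ) := by ring
    obtain ⟨a, ha⟩ := ih _ _ hz'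
    obtain ⟨b, hb⟩ := exists_norm_curl_sub_smul_eq_of_isRotatedDSS h hc0 hRe t x a
    refine ⟨b, ?_⟩
    calc ‖curl (u t) x - b • e‖
        = (c⁻¹) ^ 2 * ‖curl (u (t / c ^ 2)) (c⁻¹ • R.symm x) - a • e‖ := hb
      _ ≤ (c⁻¹) ^ 2 * (M / (c ^ 2) ^ k) := mul_le_mul_of_nonneg_left ha (sq_nonneg _)
      _ = M / (c ^ 2) ^ (k + 1) := by rw [pow_succ (c ^ 2) k, inv_pow, inv_mul_eq_div, div_div]

/-- Every `(t, x)` with `t < 0` lies in `Q_{cᵏρ}(0,0)` for all large `k` (`1 < c`, `0 < ρ`).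
[folklore] -/
theorem eventually_mem_parabolicCylinder_pow (hc : 1 < c) {ρ : ℝ} (hρ : 0 < ρ) {t : ℝ}
    (ht : t < 0) (x : EuclideanSpace ℝ (Fin 3)) :
    ∀ᶠ k : ℕ in atTop, ((t, x) : ℝ × EuclideanSpace ℝ (Fin 3)) ∈
      parabolicCylinder (c ^ k * ρ) (0 : ℝ × EuclideanSpace ℝ (Fin 3)) := by
  have hgrow : Tendsto (fun k : ℕ => c ^ k * ρ) atTop atTop :=
    (tendsto_pow_atTop_atTop_of_one_lt hc).atTop_mul_const hρ
  filter_upwards [hgrow.eventually_gt_atTop ‖x‖, hgrow.eventually_gt_atTop (Real.sqrt (-t))]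
    with k hkx hkt
  simp only [mem_parabolicCylinder, Prod.fst_zero, Prod.snd_zero, zero_sub, dist_zero_right]
  refine ⟨⟨?_, ht⟩, hkx⟩
  have hs : 0 ≤ Real.sqrt (-t) := Real.sqrt_nonneg _
  have h1 : Real.sqrt (-t) ^ 2 < (c ^ k * ρ) ^ 2 := by gcongr
  rw [Real.sq_sqrt (by linarith)] at h1
  linarith

/-- **A rotated-DSS field (`1 < c`) whose velocity stays at bounded distance from an `R`-invariant
line `ℝe` on one backward parabolic cylinder `Q_ρ(0,0)`, `ρ > 0`, is everywhere parallel to that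
line on `t < 0`** (with `e = 0`: it vanishes — Chae–Wolf's §3 Step 1).
[cite: ChaeWolf2017, §3, Step 1] -/
theorem exists_eq_smul_of_dist_axis_le_parabolicCylinder (h : IsRotatedDSS c R u) (hc : 1 < c)
    (hRe : R e = e ∨ R e = -e) {ρ M : ℝ} (hρ : 0 < ρ)
    (hM : ∀ z ∈ parabolicCylinder ρ (0 : ℝ × EuclideanSpace ℝ (Fin 3)),
      ∃ a : ℝ, ‖u z.1 z.2 - a • e‖ ≤ M) :
    ∀ t < 0, ∀ x, ∃ a : ℝ, u t x = a • e := by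
  intro t ht x
  refine ⟨⟪e, u t x⟫ / ‖e‖ ^ 2, eq_proj_smul_of_eventually_norm_sub_smul_le (M := M) hc ?_⟩
  filter_upwards [eventually_mem_parabolicCylinder_pow hc hρ ht x] with k hk
  exact dist_axis_le_of_mem_parabolicCylinder_pow h hc hRe hM k t x hk

/-- **The vorticity version**: transversal vorticity bounded on one `Q_ρ(0,0)` forces the vorticity
to be everywhere parallel to the line `ℝe` on `t < 0` (with `e = 0`: irrotational, (S14)).
[cite: ChaeWolf2017, §3, Step 1] -/
theorem exists_curl_eq_smul_of_dist_axis_le_parabolicCylinder (h : IsRotatedDSS c R u)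
    (hc : 1 < c) (hRe : R e = e ∨ R e = -e) {ρ M : ℝ} (hρ : 0 < ρ)
    (hM : ∀ z ∈ parabolicCylinder ρ (0 : ℝ × EuclideanSpace ℝ (Fin 3)),
      ∃ a : ℝ, ‖curl (u z.1) z.2 - a • e‖ ≤ M) :
    ∀ t < 0, ∀ x, ∃ a : ℝ, curl (u t) x = a • e := by
  intro t ht x
  have hc2 : 1 < c ^ 2 := by nlinarith
  refine ⟨⟪e, curl (u t) x⟫ / ‖e‖ ^ 2,
    eq_proj_smul_of_eventually_norm_sub_smul_le (M := M) hc2 ?_⟩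
  filter_upwards [eventually_mem_parabolicCylinder_pow hc hρ ht x] with k hk
  exact dist_axis_curl_le_of_mem_parabolicCylinder_pow h hc hRe hM k t x hk

end Kinematics

/-! ### §2 A unidirectional divergence-free slice is translation invariant along its direction -/

/-- **A `C²` divergence-free field everywhere parallel to a fixed `e ≠ 0` is invariant under the
translation by `e`**: writing `v = a(·) e` with `a = ⟪e, v⟫/‖e‖²`, `∂ₑa = div v = 0`, so `a` is
constant on every line `x + ℝe`. [folklore] -/
theorem eq_of_parallel_of_isDivFree {v : EuclideanSpace ℝ (Fin 3) → EuclideanSpace ℝ (Fin 3)}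
    (hv : ContDiff ℝ 2 v) (hdiv : VectorCalculus.IsDivFree v) {e : EuclideanSpace ℝ (Fin 3)}
    (he : e ≠ 0) (hpar : ∀ x, ∃ a : ℝ, v x = a • e) (x : EuclideanSpace ℝ (Fin 3)) (s : ℝ) :
    v (x + s • e) = v x := by
  have he2 : ‖e‖ ^ 2 ≠ 0 := pow_ne_zero 2 (norm_ne_zero_iff.2 he)
  -- `v = a(·) e` with a `C²` scalar `a`
  obtain ⟨a, haC, hva⟩ : ∃ a : EuclideanSpace ℝ (Fin 3) → ℝ,
      ContDiff ℝ 2 a ∧ ∀ y, v y = a y • e := by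
    refine ⟨fun y => ⟪e, v y⟫ / ‖e‖ ^ 2, (contDiff_const.inner ℝ hv).div_const _, fun y => ?_⟩
    obtain ⟨a₀, ha₀⟩ := hpar y
    show v y = (⟪e, v y⟫ / ‖e‖ ^ 2) • e
    rw [ha₀, real_inner_smul_right, real_inner_self_eq_norm_sq, mul_div_assoc, div_self he2,
      mul_one]
  have hadiff : Differentiable ℝ a := haC.differentiable two_ne_zero
  -- `∂ₑ a = div (a e) = div v = 0`
  have hDa : ∀ y, fderiv ℝ a y e = 0 := by
    intro y
    have h0 : VectorCalculus.divergence v y = 0 := hdiv y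
    have hfun : v = fun z => a z • e := funext hva
    rwa [hfun, divergence_smul_const e (hadiff y)] at h0
  -- `a` is constant along the line `x + ℝe`
  have ha_inv : a (x + s • e) = a x := by
    have hline : ∀ τ : ℝ,
        HasDerivAt (fun τ : ℝ => a (x + τ • e)) (fderiv ℝ a (x + τ • e) e) τ := by
      intro τ
      have h1 : HasDerivAt (fun τ : ℝ => x + τ • e) e τ := by
        simpa using ((hasDerivAt_id τ).smul_const e).const_add x
      exact (hadiff (x + τ • e)).hasFDerivAt.comp_hasDerivAt τ h1
    have hderiv : ∀ τ, deriv (fun τ : ℝ => a (x + τ • e)) τ = 0 := fun τ => by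
      rw [(hline τ).deriv, hDa]
    have hdiff : Differentiable ℝ (fun τ : ℝ => a (x + τ • e)) := fun τ =>
      (hline τ).differentiableAt
    simpa using is_const_of_deriv_eq_zero hdiff hderiv s 0
  rw [hva (x + s • e), hva x, ha_inv]

end Summit.NavierStokesRegularity.AngularGalerkinLadderTransversalAxisKinematics

end
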